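import Mathlib
import Summits.ResolutionOfSingularities.ResolutionOfSingularities.Theorems.WildQuotientsWildQuotientResolutionToricExitRootChartInvariantsAbstract
import Summits.ResolutionOfSingularities.ResolutionOfSingularities.Theorems.WildQuotientsWildQuotientResolutionToricExitConeDefs

/-!
# V3U cone brick, algebra half (1): the root-substitution law and the cone algebra in the even subalgebra

(crux stmt-ResolutionOfSingularities-15640 `WildQuotients.WildQuotientResolution`, line `Sketch`,
sector `|G| = p`; programme V3U of `L/w45c/CHAIN.md` v6.2 §4.0 row stub-3 «HPa THE CONE BRICK» of
`ToricExit.jordanThree_hasResolution_of_bricks` (p496627). [OURS · L1 W4.5c] — NOT a statement of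
any manuscript; replaces the role of no printed item. Prover res-L1-w45c-stub-3.)

Pure commutative algebra in `k[x₁,…,xₙ]` feeding the cone brick:

* `rootSubst_mem_adjoin` — the root substitution `ψ₀` (`x_a ↦ ρ²`, `x_b ↦ ρβ`, `x_i ↦ x_i`) lands
  in the even subalgebra `E = k[chartAGens] = k[ρ², ρβ, β², …]`.
* `fixedPoints_eq_of_rootSubst_law` — **C0-equiv by cancellation**: ANY ring endomorphism `τ` of
  `E` with `τ (ψ₀ f) = ψ₀ (σ f)` for the `J₃` datum `σ` (this is all the lifted action on the chart
  ring `Γ(V, V[x_a]) ≅ E` is known to satisfy: it is determined on `π^* k[x]`) obeys the generator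
  laws of `ToricExit.chartA_fixedPoints_eq_of_generators` (stub-1, p489617) — the law on the chart
  generator `β² = (x_b² t)/(x_a t)` follows from `ρ² · τ(β²) = τ(ψ₀ x_b²) = ψ₀((x_b + x_a)²)` by
  cancelling `ρ² ≠ 0` — hence `{τ-fixed} = k[coneGens]`.
* `adjoin_coneGens_le` — `k[coneGens] ≤ E`.

The vertex-ideal bookkeeping (cone presentation, `(ρ², ρβ, β²) ∩ k[coneGens]`, the cone quotient of
C4) is in the companion file `…ToricExitConeVertexPresentation`.
-/

-- single-problem summit: the doubled namespace component `ResolutionOfSingularities` is forced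
set_option linter.dupNamespace false

noncomputable section

open MvPolynomial

namespace Summit.ResolutionOfSingularities.ResolutionOfSingularities.Theorems.WildQuotientResolution.ToricExit

/-! ## The root substitution lands in the even subalgebra -/

/-- `ψ₀ f ∈ k[ρ², ρβ, β², …]` for the root substitution `ψ₀ : x_a ↦ ρ², x_b ↦ ρβ, x_i ↦ x_i`.
[folklore] -/
theorem rootSubst_mem_adjoin (k : Type) [Field k] (n : ℕ) (a b : Fin n)
    (f : MvPolynomial (Fin n) k) :
    MvPolynomial.aeval (fun i => if i = a then X a ^ 2 else if i = b then X a * X b else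
      (X i : MvPolynomial (Fin n) k)) f ∈ Algebra.adjoin k (chartAGens k n a b) := by
  classical
  induction f using MvPolynomial.induction_on with
  | C t =>
    rw [← MvPolynomial.algebraMap_eq, AlgHom.commutes]
    exact Subalgebra.algebraMap_mem _ _
  | add p q hp hq =>
    rw [map_add]
    exact Subalgebra.add_mem _ hp hq
  | mul_X p i hp =>
    rw [map_mul, aeval_X]
    refine Subalgebra.mul_mem _ hp ?_
    by_cases hia : i = a
    · subst hia
      rw [if_pos rfl]
      exact sq_a_mem_adjoin k n i b
    · by_cases hib : i = b
      · subst hib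
        rw [if_neg hia, if_pos rfl]
        exact mul_ab_mem_adjoin k n a i
      · rw [if_neg hia, if_neg hib]
        exact X_mem_adjoin_of_ne k n a b i hia hib

/-! ## C0-equiv by cancellation: the fixed subring of an endomorphism with the root-substitution law -/

/-- **Fixed points of an endomorphism of the even subalgebra obeying the root-substitution law.**
Let `σ` be the `J₃` datum (`σ x_b = x_b + x_a`, `σ x_c = x_c + x_b`, other variables fixed) in
characteristic `p ≥ 3`, and `τ` a ring endomorphism of `E = k[ρ², ρβ, β², …]` with
`τ (ψ₀ f) = ψ₀ (σ f)` for all `f ∈ k[x]`. Then `{e ∈ E | τ e = e} = {e ∈ E | e ∈ k[coneGens]}`.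
The generator laws of `chartA_fixedPoints_eq_of_generators` hold: on `ρ² = ψ₀ x_a`,
`ρβ = ψ₀ x_b`, `x_c = ψ₀ x_c` and the passengers directly, and on `β²` by cancelling `ρ²` in
`ρ² · τ(β²) = τ(ψ₀ (x_b²)) = ψ₀ ((x_b + x_a)²) = ρ² (β² + 2ρβ + ρ²)`. [OURS · L1 W4.5c] [folklore] -/
theorem fixedPoints_eq_of_rootSubst_law (p : ℕ) (hp : p.Prime) (hp3 : 3 ≤ p) (k : Type)
    [Field k] [CharP k p] (n : ℕ) (σ : MvPolynomial (Fin n) k ≃ₐ[k] MvPolynomial (Fin n) k)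
    (a b c : Fin n) (hab : a ≠ b) (hbc : b ≠ c) (hac : a ≠ c)
    (hb : σ (X b) = X b + X a) (hc : σ (X c) = X c + X b)
    (hσ : ∀ i, i ≠ b → i ≠ c → σ (X i) = X i)
    (τ : ↥(Algebra.adjoin k (chartAGens k n a b)) →+* ↥(Algebra.adjoin k (chartAGens k n a b)))
    (hτ : ∀ f : MvPolynomial (Fin n) k,
      ((τ ⟨MvPolynomial.aeval (fun i => if i = a then X a ^ 2 else if i = b then X a * X b else
        (X i : MvPolynomial (Fin n) k)) f, rootSubst_mem_adjoin k n a b f⟩ :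
          ↥(Algebra.adjoin k (chartAGens k n a b))) : MvPolynomial (Fin n) k) =
        MvPolynomial.aeval (fun i => if i = a then X a ^ 2 else if i = b then X a * X b else
          (X i : MvPolynomial (Fin n) k)) (σ f)) :
    {e : ↥(Algebra.adjoin k (chartAGens k n a b)) | τ e = e} =
      {e : ↥(Algebra.adjoin k (chartAGens k n a b)) |
        (e : MvPolynomial (Fin n) k) ∈ Algebra.adjoin k (coneGens k p n a b c)} := by
  classical
  set ψ₀ : MvPolynomial (Fin n) k →ₐ[k] MvPolynomial (Fin n) k :=
    MvPolynomial.aeval (fun i => if i = a then X a ^ 2 else if i = b then X a * X b else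
      (X i : MvPolynomial (Fin n) k)) with hψ₀
  have hba : b ≠ a := fun h => hab h.symm
  have hca : c ≠ a := fun h => hac h.symm
  have hcb : c ≠ b := fun h => hbc h.symm
  have ha : σ (X a) = X a := hσ a hab hac
  have hψa : ψ₀ (X a) = X a ^ 2 := by simp [ψ₀]
  have hψb : ψ₀ (X b) = X a * X b := by simp [ψ₀, hba]
  have hψi : ∀ i, i ≠ a → i ≠ b → ψ₀ (X i) = X i := fun i hi hi' => by simp [ψ₀, hi, hi']
  have hψc : ψ₀ (X c) = X c := hψi c hca hcb
  -- the generator elements of `E` are `ψ₀`-images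
  have key : ∀ (f : MvPolynomial (Fin n) k) (y : MvPolynomial (Fin n) k) (hy : ψ₀ f = y)
      (hyE : y ∈ Algebra.adjoin k (chartAGens k n a b)),
      ((τ ⟨y, hyE⟩ : ↥(Algebra.adjoin k (chartAGens k n a b))) : MvPolynomial (Fin n) k) =
        ψ₀ (σ f) := by
    intro f y hy hyE
    have e : (⟨y, hyE⟩ : ↥(Algebra.adjoin k (chartAGens k n a b))) =
        ⟨ψ₀ f, rootSubst_mem_adjoin k n a b f⟩ := Subtype.ext hy.symm
    rw [e]
    exact hτ f
  refine chartA_fixedPoints_eq_of_generators p hp hp3 k n a b c hab hbc hac τ ?_ ?_ ?_ ?_ ?_ ?_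
  · -- constants
    intro r
    have h1 : ψ₀ (C r) = C r := by rw [← MvPolynomial.algebraMap_eq, AlgHom.commutes]
    have hCE : (C r : MvPolynomial (Fin n) k) ∈ Algebra.adjoin k (chartAGens k n a b) := by
      rw [← MvPolynomial.algebraMap_eq]; exact Subalgebra.algebraMap_mem _ r
    have h2 : (algebraMap k ↥(Algebra.adjoin k (chartAGens k n a b)) r :
        ↥(Algebra.adjoin k (chartAGens k n a b))) = ⟨C r, hCE⟩ := by
      apply Subtype.ext
      rw [Subalgebra.coe_algebraMap, MvPolynomial.algebraMap_eq]
    have hCr : σ (C r) = C r := by rw [← MvPolynomial.algebraMap_eq, AlgEquiv.commutes]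
    rw [h2, key (C r) (C r) h1, hCr, h1]
  · -- `ρ²`
    rw [key (X a) (X a ^ 2) hψa, ha, hψa]
  · -- `ρβ`
    rw [key (X b) (X a * X b) hψb, hb, map_add, hψa, hψb]
  · -- `β²`, by cancellation of `ρ²`
    have hprod : (⟨X a ^ 2, sq_a_mem_adjoin k n a b⟩ : ↥(Algebra.adjoin k (chartAGens k n a b))) *
        ⟨X b ^ 2, sq_b_mem_adjoin k n a b⟩ = ⟨ψ₀ (X b ^ 2), rootSubst_mem_adjoin k n a b _⟩ := by
      apply Subtype.ext
      change X a ^ 2 * X b ^ 2 = ψ₀ (X b ^ 2)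
      rw [map_pow, hψb]; ring
    have h1 := congrArg (fun e : ↥(Algebra.adjoin k (chartAGens k n a b)) =>
      (e : MvPolynomial (Fin n) k)) (congrArg τ hprod)
    simp only [map_mul, Subalgebra.coe_mul] at h1
    rw [key (X a) (X a ^ 2) hψa, ha, hψa, hτ (X b ^ 2), map_pow, hb, map_pow, map_add, hψa,
      hψb] at h1
    have h2 : (X a ^ 2 : MvPolynomial (Fin n) k) *
        (((τ ⟨X b ^ 2, sq_b_mem_adjoin k n a b⟩ : ↥(Algebra.adjoin k (chartAGens k n a b))) :
          MvPolynomial (Fin n) k) - (X b ^ 2 + 2 * (X a * X b) + X a ^ 2)) = 0 := by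
      rw [mul_sub, h1]; ring
    have hXa : (X a ^ 2 : MvPolynomial (Fin n) k) ≠ 0 := pow_ne_zero 2 (X_ne_zero a)
    exact sub_eq_zero.mp ((mul_eq_zero.mp h2).resolve_left hXa)
  · -- `x_c`
    rw [key (X c) (X c) hψc, hc, map_add, hψc, hψb]
  · -- passengers
    intro i hia hib hic
    rw [key (X i) (X i) (hψi i hia hib), hσ i hib hic, hψi i hia hib]

/-! ## The cone algebra inside the even subalgebra -/

/-- `k[coneGens] ≤ k[chartAGens]`: the cone algebra consists of (`σ_U`-fixed) elements of the even
subalgebra (stub-1's C2 `chartA_fixedPoints_eq`, p489078). [folklore] -/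
theorem adjoin_coneGens_le (p : ℕ) (hp : p.Prime) (hp3 : 3 ≤ p) (k : Type) [Field k] [CharP k p]
    (n : ℕ) (a b c : Fin n) (hab : a ≠ b) (hbc : b ≠ c) (hac : a ≠ c) :
    Algebra.adjoin k (coneGens k p n a b c) ≤ Algebra.adjoin k (chartAGens k n a b) := by
  obtain ⟨σU, hb, hc, hσU⟩ := exists_rootChartEquiv k n a b c hab hbc hac
  intro f hf
  have h := chartA_fixedPoints_eq p hp hp3 k n σU a b c hab hbc hac hb hc hσU
  have hf' : f ∈ (Algebra.adjoin k (coneGens k p n a b c) : Set (MvPolynomial (Fin n) k)) := hf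
  rw [← h] at hf'
  exact hf'.1

end Summit.ResolutionOfSingularities.ResolutionOfSingularities.Theorems.WildQuotientResolution.ToricExit

end
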